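import Mathlib

/-!
# No finite-degree invariant separates the stuck Cappell–Shaneson classes of trace 70 (solo-blind s5)

Pure algebra behind the Proposition of `paper/cs-gompf-classes.md` §4b (solo seat `solo-SmoothPoincare4-blind`).

*Setting.* Gompf equivalence classes of Cappell–Shaneson matrices of trace `70` correspond to the
`44` ideal classes of `ℤ[θ₇₀]` (`Cl ≅ ℤ/44`, PARI-certified); `42` of them carry kernel-checked chains of
Gompf moves to Gompf's standard matrix (`Theorems/SoloBlindCS70.lean`), the remaining two are
`x = [X_{37,155,70}]` and `x⁻¹ = [X_{104,141,70}]`.  A *Gompf invariant* restricted to trace `70` is therefore a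
function `f : ℤ/44 → A` that is constant off `{x, x⁻¹}`.  The theorems below show that if such an `f` has
FINITE DEGREE (iterated finite differences of some fixed order vanish — this covers additive invariants,
Rédei/Massey-type multilinear residue-symbol recipes in the prime factorisation of the state ideal, and
finite-degree heights) then `f x = f 0`: no invariant of that kind can detect `x`.

*Mathematics.* For a step `k` of additive order dividing `r` and a function `f` on an abelian group with
`(Δₖ)^{m+1} f = 0`, the difference `f (y + k) - f y` is killed by `r ^ m` (telescoping + induction on `m`:
`r^m • Δₖ f` is `k`-periodic and sums to zero over a period).  Two such directions of coprime orders whose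
cosets through `σ` both meet the set where `f` is constant force `f σ` to equal that constant (Bezout).
In `ℤ/44` the directions `4` (order `11`) and `11` (order `4`) do this for any exceptional set of size `≤ 2`.
The hypothesis "`(Δₖ)^{m+1} f = 0` for every step `k`" is implied by the usual definition of degree `≤ m`
(all `(m+1)`-fold mixed differences vanish), so the statements are slightly stronger than needed.
-/

namespace Summit.SmoothPoincare4.SmoothPoincare4.Theorems.NoFiniteDegree

open Finset

variable {G A : Type*} [AddCommGroup G] [AddCommGroup A]

/-- Forward difference with step `k`. -/
def fd (k : G) (f : G → A) : G → A := fun x => f (x + k) - f x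

/-- Unfolding lemma for `fd`. -/
theorem fd_apply (k : G) (f : G → A) (x : G) : fd k f x = f (x + k) - f x := rfl

/-- Telescoping sum of `k`-differences along `n` consecutive translates. -/
theorem sum_fd_range (k : G) (f : G → A) (x : G) (n : ℕ) :
    ∑ i ∈ range n, fd k f (x + i • k) = f (x + n • k) - f x := by
  induction n with
  | zero => simp
  | succ n ih =>
    rw [sum_range_succ, ih, fd_apply, succ_nsmul, ← add_assoc]
    abel

/-- Telescoping: the sum of `Δₖ f` over `r` consecutive `k`-translates vanishes when `r • k = 0`. -/
theorem tel_fd_of_torsion (k : G) (r : ℕ) (hk : r • k = 0) (f : G → A) :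
    ∀ x, ∑ i ∈ range r, fd k f (x + i • k) = 0 := by
  intro x
  rw [sum_fd_range, hk, add_zero, sub_self]

/-- The telescoping property passes from `g` to `Δₖ g`. -/
theorem tel_fd (k : G) (r : ℕ) (g : G → A) (hg : ∀ x, ∑ i ∈ range r, g (x + i • k) = 0) :
    ∀ x, ∑ i ∈ range r, fd k g (x + i • k) = 0 := by
  intro x
  simp only [fd_apply, sum_sub_distrib]
  have e : ∑ i ∈ range r, g (x + i • k + k) = ∑ i ∈ range r, g (x + k + i • k) := by
    apply sum_congr rfl
    intro i _
    congr 1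
    abel
  rw [e, hg (x + k), hg x, sub_zero]

/-- Core lemma: a function with the telescoping property and vanishing `m`-th `k`-difference is killed by `r ^ m`. -/
theorem torsion_of_tel_of_iterate (k : G) (r : ℕ) :
    ∀ (m : ℕ) (g : G → A), (∀ x, ∑ i ∈ range r, g (x + i • k) = 0) →
      (∀ x, (fd k)^[m] g x = 0) → ∀ x, (r ^ m) • g x = 0 := by
  intro m
  induction m with
  | zero =>
    intro g _ h x
    simpa using h x
  | succ m ih =>
    intro g hg hdeg x
    have hper : ∀ y, (r ^ m) • fd k g y = 0 :=
      ih (fd k g) (tel_fd k r g hg) (fun y => by simpa [Function.iterate_succ_apply] using hdeg y)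
    have hp : ∀ y, (r ^ m) • g (y + k) = (r ^ m) • g y := by
      intro y
      have h := hper y
      rw [fd_apply, smul_sub, sub_eq_zero] at h
      exact h
    have hpi : ∀ i : ℕ, (r ^ m) • g (x + i • k) = (r ^ m) • g x := by
      intro i
      induction i with
      | zero => simp
      | succ i ih2 => rw [succ_nsmul, ← add_assoc, hp, ih2]
    have hs := congrArg (fun a => (r ^ m) • a) (hg x)
    simp only [smul_sum, smul_zero] at hs
    rw [sum_congr rfl (fun i _ => hpi i), sum_const, card_range, smul_smul] at hs
    rw [pow_succ, mul_comm]
    exact hs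

/-- If `(Δₖ)^{m+1} f = 0` and `r • k = 0` then `r ^ m` kills every `k`-step difference of `f`. -/
theorem torsion_step (f : G → A) (k : G) (r m : ℕ) (hk : r • k = 0)
    (hdeg : ∀ x, (fd k)^[m + 1] f x = 0) : ∀ x, (r ^ m) • (f (x + k) - f x) = 0 := by
  have h := torsion_of_tel_of_iterate k r m (fd k f) (tel_fd_of_torsion k r hk f)
    (fun y => by simpa [Function.iterate_succ_apply] using hdeg y)
  intro x
  simpa [fd_apply] using h x

/-- Same along `j` steps. -/
theorem torsion_multistep (f : G → A) (k : G) (r m : ℕ) (hk : r • k = 0)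
    (hdeg : ∀ x, (fd k)^[m + 1] f x = 0) : ∀ (j : ℕ) (x : G), (r ^ m) • (f (x + j • k) - f x) = 0 := by
  intro j
  induction j with
  | zero => intro x; simp
  | succ j ih =>
    intro x
    have h1 := ih x
    have h2 := torsion_step f k r m hk hdeg (x + j • k)
    have e : f (x + (j + 1) • k) - f x = (f (x + j • k + k) - f (x + j • k)) + (f (x + j • k) - f x) := by
      rw [succ_nsmul, ← add_assoc]
      abel
    rw [e, smul_add, h1, h2, add_zero]

/-- Two directions of coprime additive orders: if the `k₁`-coset and the `k₂`-coset through `σ` contain points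
where `f` takes a common value, a finite-degree `f` takes that value at `σ` too. -/
theorem eq_of_finiteDegree_two_directions (f : G → A) (m : ℕ) {k₁ k₂ : G} {r₁ r₂ : ℕ}
    (h₁ : r₁ • k₁ = 0) (h₂ : r₂ • k₂ = 0) (hcop : Nat.Coprime r₁ r₂)
    (hdeg₁ : ∀ x, (fd k₁)^[m + 1] f x = 0) (hdeg₂ : ∀ x, (fd k₂)^[m + 1] f x = 0)
    (σ : G) (j₁ j₂ : ℕ) (hval : f (σ + j₁ • k₁) = f (σ + j₂ • k₂)) : f σ = f (σ + j₁ • k₁) := by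
  set a := f (σ + j₁ • k₁) - f σ with ha
  have t1 : (r₁ ^ m) • a = 0 := torsion_multistep f k₁ r₁ m h₁ hdeg₁ j₁ σ
  have t2 : (r₂ ^ m) • a = 0 := by
    rw [ha, hval]
    exact torsion_multistep f k₂ r₂ m h₂ hdeg₂ j₂ σ
  have t1' : ((r₁ ^ m : ℕ) : ℤ) • a = 0 := by rw [natCast_zsmul]; exact t1
  have t2' : ((r₂ ^ m : ℕ) : ℤ) • a = 0 := by rw [natCast_zsmul]; exact t2
  have hc : Nat.Coprime (r₁ ^ m) (r₂ ^ m) := Nat.Coprime.pow m m hcop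
  obtain ⟨u, v, huv⟩ := Nat.isCoprime_iff_coprime.mpr hc
  have hz : a = 0 := by
    calc a = (u * ((r₁ ^ m : ℕ) : ℤ) + v * ((r₂ ^ m : ℕ) : ℤ)) • a := by rw [huv, one_smul]
      _ = u • (((r₁ ^ m : ℕ) : ℤ) • a) + v • (((r₂ ^ m : ℕ) : ℤ) • a) := by rw [add_smul, mul_smul, mul_smul]
      _ = 0 := by rw [t1', t2', smul_zero, smul_zero, add_zero]
  have : f (σ + j₁ • k₁) - f σ = 0 := hz
  exact (sub_eq_zero.mp this).symm

/-- Combinatorial input for `ℤ/44`: one of `σ + 4`, `σ + 8` avoids `{σ, σ'}`, and one of `σ + 11`, `σ + 22` does. -/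
theorem zmod44_witnesses (σ σ' : ZMod 44) :
    ((σ + (1 : ℕ) • (4 : ZMod 44) ≠ σ ∧ σ + (1 : ℕ) • (4 : ZMod 44) ≠ σ') ∨
      (σ + (2 : ℕ) • (4 : ZMod 44) ≠ σ ∧ σ + (2 : ℕ) • (4 : ZMod 44) ≠ σ')) ∧
    ((σ + (1 : ℕ) • (11 : ZMod 44) ≠ σ ∧ σ + (1 : ℕ) • (11 : ZMod 44) ≠ σ') ∨
      (σ + (2 : ℕ) • (11 : ZMod 44) ≠ σ ∧ σ + (2 : ℕ) • (11 : ZMod 44) ≠ σ')) := by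
  revert σ σ'
  decide

/-- **No finite-degree invariant on `ℤ/44` separates a two-element set.**  If `f : ℤ/44 → A` has finite
degree (`(Δₖ)^{m+1} f = 0` for every step `k`) and is constant (`= f 0`) outside `{σ, σ'}`, then `f σ = f 0`.
Application (trace 70): `A`-valued Gompf invariants that are finite-degree functions of the ideal class cannot
distinguish `X_{37,155,70}` (or `X_{104,141,70}`) from Gompf's standard matrix. -/
theorem zmod44_eq_of_finiteDegree (f : ZMod 44 → A) (m : ℕ)
    (hdeg : ∀ (k x : ZMod 44), (fd k)^[m + 1] f x = 0)
    (σ σ' : ZMod 44) (hoff : ∀ x, x ≠ σ → x ≠ σ' → f x = f 0) : f σ = f 0 := by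
  have h₁ : (11 : ℕ) • (4 : ZMod 44) = 0 := by decide
  have h₂ : (4 : ℕ) • (11 : ZMod 44) = 0 := by decide
  have hcop : Nat.Coprime 11 4 := by decide
  obtain ⟨hA, hB⟩ := zmod44_witnesses σ σ'
  -- pick j₁ ∈ {1,2} and j₂ ∈ {1,2}
  have key : ∀ (j₁ j₂ : ℕ), (σ + j₁ • (4 : ZMod 44) ≠ σ ∧ σ + j₁ • (4 : ZMod 44) ≠ σ') →
      (σ + j₂ • (11 : ZMod 44) ≠ σ ∧ σ + j₂ • (11 : ZMod 44) ≠ σ') → f σ = f 0 := by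
    intro j₁ j₂ hj₁ hj₂
    have e1 : f (σ + j₁ • (4 : ZMod 44)) = f 0 := hoff _ hj₁.1 hj₁.2
    have e2 : f (σ + j₂ • (11 : ZMod 44)) = f 0 := hoff _ hj₂.1 hj₂.2
    have := eq_of_finiteDegree_two_directions f m h₁ h₂ hcop (hdeg 4) (hdeg 11) σ j₁ j₂ (e1.trans e2.symm)
    rw [this, e1]
  rcases hA with hA | hA <;> rcases hB with hB | hB
  · exact key 1 1 hA hB
  · exact key 1 2 hA hB
  · exact key 2 1 hA hB
  · exact key 2 2 hA hB

end Summit.SmoothPoincare4.SmoothPoincare4.Theorems.NoFiniteDegree
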